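import Summits.QuantumAdvantage.QuantumAdvantage.Theorems.CubicForrelationNearExactIsExactTenBalancedA
import Summits.QuantumAdvantage.QuantumAdvantage.Theorems.CubicForrelationNearExactIsExactRothausB

/-!
# Crux `CubicForrelation.NearExactIsExact` (stmt-QuantumAdvantage-14043), line `direct-sum-amplification`,
  lead c6 cycle 3: stub `stub_rmUniqueDecoding` — unique decoding of `RM(3,9)` within radius `31`

The f-side of the `n = 10` census: the partner's restriction to the heavy hyperplane is a 9-variable cubic within
Hamming distance `31` of the Walsh sign word `t`, hence it is UNIQUE.  Precisely: if `F, G` are cubic Boolean functions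
on `9` bits, both within Hamming distance `31` of the same word `t`, then `F = G`.

Proof.  `e := F ⊕ G` is cubic (`bb_isDegLeFun_bxor`, sum of the representing polynomials over `𝔽₂`) and
`{e = 1} = {F ≠ G} ⊆ {F ≠ t} ∪ {G ≠ t}`, so `#{e = 1} ≤ 31 + 31 = 62` (`Finset.card_union_le`).  If `F x ≠ G x` for
some `x` then `e x = 1`, and the Reed–Muller minimum weight (`bb_rmWeight_holds`, the landed stubs R + D of the line:
a non-zero word of `RM(d,m)` has weight `≥ 2^{m−d}`, division-free `2^m ≤ 2^d · wt`) gives `2⁹ ≤ 2³ · 62 = 496 < 512`,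
a contradiction; hence `F = G` pointwise.  (This is the classical statement that `RM(3,9)`, of minimum distance
`2⁶ = 64`, decodes uniquely within radius `31 < 64/2`.)

References: C. Carlet, *Boolean Functions for Cryptography and Coding Theory*, CUP 2021, §4.1 Thm 7 (minimum distance
of Reed–Muller codes); F. J. MacWilliams, N. J. A. Sloane, *The Theory of Error-Correcting Codes* (1977), Ch. 1 §3
Thm 2 (a code of minimum distance `d` corrects `⌊(d−1)/2⌋` errors) and Ch. 13 §3.  Everything is proved from Mathlib
and the tree (`bb_isDegLeFun_bxor`, `bb_rmWeight_holds`); axioms are the standard three.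
-/

set_option linter.dupNamespace false -- D-0017: single-problem summit ⇒ `QuantumAdvantage.QuantumAdvantage` by design

noncomputable section

namespace Summit.QuantumAdvantage.QuantumAdvantage.Theorems.CubicForrelation.NearExactIsExact

open Finset
open Literature.Computability.QuantumComplexity

/-! ### Hamming-distance plumbing -/

/-- The support of `F ⊕ G` lies in the union of the disagreement sets of `F` and of `G` with any third word `t`
(the triangle inequality for the Hamming distance, set form). [folklore] -/
theorem ud_filter_bxor_subset {α : Type*} [Fintype α] [DecidableEq α] (F G t : α → Bool) :
    (univ.filter fun x => (F x ^^ G x) = true) ⊆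
      (univ.filter fun x => F x ≠ t x) ∪ (univ.filter fun x => G x ≠ t x) := by
  intro x hx
  simp only [mem_filter, mem_union, mem_univ, true_and] at hx ⊢
  revert hx
  cases F x <;> cases G x <;> cases t x <;> decide

/-- The weight of `F ⊕ G` is at most `d(F,t) + d(G,t)` (triangle inequality for the Hamming distance). [folklore] -/
theorem ud_card_bxor_le {α : Type*} [Fintype α] [DecidableEq α] (F G t : α → Bool) :
    (univ.filter fun x => (F x ^^ G x) = true).card ≤
      (univ.filter fun x => F x ≠ t x).card + (univ.filter fun x => G x ≠ t x).card :=
  (card_le_card (ud_filter_bxor_subset F G t)).trans (card_union_le _ _)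

/-- Two Boolean functions that differ at a point have a non-zero xor. [folklore] -/
theorem ud_exists_bxor_of_ne {α : Type*} {F G : α → Bool} {x : α} (h : F x ≠ G x) : ∃ y, (F y ^^ G y) = true :=
  ⟨x, by revert h; cases F x <;> cases G x <;> decide⟩

/-! ### Unique decoding of `RM(3,9)` within radius `31` -/

/-- **Unique decoding of `RM(3,9)` within radius `31`.** Two cubic Boolean functions on `9` bits that are both within
Hamming distance `31` of the same word `t` coincide: their xor is a cubic of weight `≤ 62 < 64 = 2^{9−3}`, so it
vanishes by the Reed–Muller minimum weight `bb_rmWeight_holds`. [cite: Carlet2020, §4.1 Thm 7] -/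
theorem stub_rmUniqueDecoding :
    ∀ (F G t : (Fin (4 + 4 + 1) → Bool) → Bool), IsDegLeFun 3 F → IsDegLeFun 3 G →
      (univ.filter fun x : Fin (4 + 4 + 1) → Bool => F x ≠ t x).card ≤ 31 →
      (univ.filter fun x : Fin (4 + 4 + 1) → Bool => G x ≠ t x).card ≤ 31 → F = G := by
  intro F G t hF hG hFt hGt
  funext x
  by_contra hx
  -- `e := F ⊕ G` is a non-zero cubic of weight `≤ 62`
  have hR : 2 ^ (4 + 4 + 1) ≤ 2 ^ 3 * (univ.filter fun y : Fin (4 + 4 + 1) → Bool => (F y ^^ G y) = true).card :=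
    bb_rmWeight_holds (4 + 4 + 1) 3 (fun y => F y ^^ G y) (bb_isDegLeFun_bxor hF hG) (ud_exists_bxor_of_ne hx)
  have hW := ud_card_bxor_le F G t
  -- `512 ≤ 8 · 62 = 496` is absurd
  omega

end Summit.QuantumAdvantage.QuantumAdvantage.Theorems.CubicForrelation.NearExactIsExact
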